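import Summits.PneNP.PneNP.Theorems.SymmetryBudgetNoHiddenOrderProgramLvlsA

/-!
# `NoHiddenOrder` (stmt-PneNP-14781), (R2c) VI: the window canoniser program — local levels of the `VecCmp` shapes

Route `PneNP/SymmetryBudget`; continuation of `…ProgramLvlsA.lean`: local levels `vsLvl`/`voLvl`/`vaLvl` of the three `VecCmp` shapes of
`…ProgramSrcsA.lean` with `vsSrcs_lvl`/`voSrcs_lvl`/`vaSrcs_lvl` (every source is an internal gate of smaller level or a bit wire) and the
bounds `≤ 3`.  Sorry-free; supports stmt-PneNP-14781, does not close it.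
-/

set_option linter.dupNamespace false -- `Summit.PneNP.PneNP.…` (D-0017 single-conjunct layout)

namespace Summit.PneNP.PneNP.Theorems

open Finset Literature.Computability.Complexity Literature.Computability.Complexity.SymProg CGBits BranchSum

namespace WCanon

variable {m : ℕ}

/-! ### The three `VecCmp` shapes -/

/-- Local level of the signature comparison shape. [folklore] -/
def vsLvl : VSGate m → ℕ
  | .both _ _ _ => 0
  | .none _ _ _ => 0
  | .eqv _ _ _ => 1
  | .nb _ _ => 0
  | .lt _ _ _ => 2
  | .less _ _ => 3
  | .eqall _ _ => 2

/-- `vsLvl ≤ 3`. [folklore] -/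
theorem vsLvl_le (g : VSGate m) : vsLvl g ≤ 3 := by
  cases g <;> simp [vsLvl]

/-- **Sources of the signature comparison shape are internal of smaller level, or bit wires.** [folklore] -/
theorem vsSrcs_lvl {b : WV m → Fin (m + m) → Wire m} {e : VSGate m → Gt m} {g : VSGate m} {w : Wire m} (hw : w ∈ vsSrcs b e g) :
    (∃ g', w = Sum.inr (e g') ∧ vsLvl g' < vsLvl g) ∨ (∃ k j, w = b k j) := by
  cases g with
  | both k k' j =>
    simp only [vsSrcs, mem_insert, mem_singleton] at hw
    rcases hw with rfl | rfl <;> exact Or.inr ⟨_, _, rfl⟩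
  | none k k' j =>
    simp only [vsSrcs, mem_insert, mem_singleton] at hw
    rcases hw with rfl | rfl <;> exact Or.inr ⟨_, _, rfl⟩
  | eqv k k' j =>
    simp only [vsSrcs, mem_insert, mem_singleton] at hw
    rcases hw with rfl | rfl <;> exact lvl_inl (by simp [vsLvl])
  | nb k j =>
    simp only [vsSrcs, mem_singleton] at hw
    rcases hw with rfl
    exact Or.inr ⟨_, _, rfl⟩
  | lt k k' j =>
    simp only [vsSrcs, mem_union, mem_image, mem_filter, mem_univ, true_and, mem_insert, mem_singleton] at hw
    rcases hw with ⟨q, -, rfl⟩ | rfl | rfl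
    · exact lvl_inl (by simp [vsLvl])
    · exact lvl_inl (by simp [vsLvl])
    · exact Or.inr ⟨_, _, rfl⟩
  | less k k' =>
    simp only [vsSrcs, mem_image, mem_univ, true_and] at hw
    obtain ⟨j, rfl⟩ := hw
    exact lvl_inl (by simp [vsLvl])
  | eqall k k' =>
    simp only [vsSrcs, mem_image, mem_univ, true_and] at hw
    obtain ⟨j, rfl⟩ := hw
    exact lvl_inl (by simp [vsLvl])

/-- Local level of the candidates' comparison shape. [folklore] -/
def voLvl : VOGate m → ℕ
  | .both _ _ _ => 0
  | .none _ _ _ => 0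
  | .eqv _ _ _ => 1
  | .nb _ _ => 0
  | .lt _ _ _ => 2
  | .less _ _ => 3
  | .eqall _ _ => 2

/-- `voLvl ≤ 3`. [folklore] -/
theorem voLvl_le (g : VOGate m) : voLvl g ≤ 3 := by
  cases g <;> simp [voLvl]

/-- **Sources of the candidates' comparison shape are internal of smaller level, or bit wires.** [folklore] -/
theorem voSrcs_lvl {b : WV m × Fin (wn m) → Fin (NB (wn m)) → Wire m} {e : VOGate m → Gt m} {g : VOGate m} {w : Wire m}
    (hw : w ∈ voSrcs b e g) : (∃ g', w = Sum.inr (e g') ∧ voLvl g' < voLvl g) ∨ (∃ k j, w = b k j) := by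
  cases g with
  | both k k' j =>
    simp only [voSrcs, mem_insert, mem_singleton] at hw
    rcases hw with rfl | rfl <;> exact Or.inr ⟨_, _, rfl⟩
  | none k k' j =>
    simp only [voSrcs, mem_insert, mem_singleton] at hw
    rcases hw with rfl | rfl <;> exact Or.inr ⟨_, _, rfl⟩
  | eqv k k' j =>
    simp only [voSrcs, mem_insert, mem_singleton] at hw
    rcases hw with rfl | rfl <;> exact lvl_inl (by simp [voLvl])
  | nb k j =>
    simp only [voSrcs, mem_singleton] at hw
    rcases hw with rfl
    exact Or.inr ⟨_, _, rfl⟩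
  | lt k k' j =>
    simp only [voSrcs, mem_union, mem_image, mem_filter, mem_univ, true_and, mem_insert, mem_singleton] at hw
    rcases hw with ⟨q, -, rfl⟩ | rfl | rfl
    · exact lvl_inl (by simp [voLvl])
    · exact lvl_inl (by simp [voLvl])
    · exact Or.inr ⟨_, _, rfl⟩
  | less k k' =>
    simp only [voSrcs, mem_image, mem_univ, true_and] at hw
    obtain ⟨j, rfl⟩ := hw
    exact lvl_inl (by simp [voLvl])
  | eqall k k' =>
    simp only [voSrcs, mem_image, mem_univ, true_and] at hw
    obtain ⟨j, rfl⟩ := hw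
    exact lvl_inl (by simp [voLvl])

/-- Local level of the parts' comparison shape. [folklore] -/
def vaLvl : VAGate m → ℕ
  | .both _ _ _ => 0
  | .none _ _ _ => 0
  | .eqv _ _ _ => 1
  | .nb _ _ => 0
  | .lt _ _ _ => 2
  | .less _ _ => 3
  | .eqall _ _ => 2

/-- `vaLvl ≤ 3`. [folklore] -/
theorem vaLvl_le (g : VAGate m) : vaLvl g ≤ 3 := by
  cases g <;> simp [vaLvl]

/-- **Sources of the parts' comparison shape are internal of smaller level, or bit wires.** [folklore] -/
theorem vaSrcs_lvl {b : Finset (WV m) → Fin (NB (wn m)) → Wire m} {e : VAGate m → Gt m} {g : VAGate m} {w : Wire m}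
    (hw : w ∈ vaSrcs b e g) : (∃ g', w = Sum.inr (e g') ∧ vaLvl g' < vaLvl g) ∨ (∃ k j, w = b k j) := by
  cases g with
  | both k k' j =>
    simp only [vaSrcs, mem_insert, mem_singleton] at hw
    rcases hw with rfl | rfl <;> exact Or.inr ⟨_, _, rfl⟩
  | none k k' j =>
    simp only [vaSrcs, mem_insert, mem_singleton] at hw
    rcases hw with rfl | rfl <;> exact Or.inr ⟨_, _, rfl⟩
  | eqv k k' j =>
    simp only [vaSrcs, mem_insert, mem_singleton] at hw
    rcases hw with rfl | rfl <;> exact lvl_inl (by simp [vaLvl])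
  | nb k j =>
    simp only [vaSrcs, mem_singleton] at hw
    rcases hw with rfl
    exact Or.inr ⟨_, _, rfl⟩
  | lt k k' j =>
    simp only [vaSrcs, mem_union, mem_image, mem_filter, mem_univ, true_and, mem_insert, mem_singleton] at hw
    rcases hw with ⟨q, -, rfl⟩ | rfl | rfl
    · exact lvl_inl (by simp [vaLvl])
    · exact lvl_inl (by simp [vaLvl])
    · exact Or.inr ⟨_, _, rfl⟩
  | less k k' =>
    simp only [vaSrcs, mem_image, mem_univ, true_and] at hw
    obtain ⟨j, rfl⟩ := hw
    exact lvl_inl (by simp [vaLvl])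
  | eqall k k' =>
    simp only [vaSrcs, mem_image, mem_univ, true_and] at hw
    obtain ⟨j, rfl⟩ := hw
    exact lvl_inl (by simp [vaLvl])

end WCanon

end Summit.PneNP.PneNP.Theorems
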